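import Summits.Schanuel.Schanuel.Theorems.RootDecomp1KRunge01

/-!
# RootDecomp1KRunge — lens 1, generation 57, NODE 18 «RUNGE ON THE K-LINE» (2-adic Runge's method at x = ∞; RULE K-R48 payable clause; CLAIM L2698, PRICE L2701, K-R49) — continuation (RootDecomp1KRunge02): §3 Runge estimate, §4 the integer Z, §5 endgame

(lens-1 g57 NODE 18 HOME kernel K = HOME/decomp-schanuel-lens-1/g57/Runge.lean 42801ffe…, 1394 l, 113 thm + structure RungeCert + integer-table defs, imports tree …RootDecomp1KParamThueMahler03 ONLY = the port of node 17 (no Literature import, no fact def, no private; two local `set_option maxHeartbeats … in` as in K); Probe / Ctrl0 / Ctrl + NODE-g57.md + SHA256SUMS; CLAIM L2698, census LIVENESS-v8 L2699 (of record L2701) / LIVENESS-v9 L2703, writer CHECK NOTE L2700 (certificate arithmetic reproduces), crit g10 EX-ANTE PRICE L2701 (ONE THEOREM ×1 for (A) engine + (B) binder discharge thinFibreAt_M17P + (C) the family RW jointly iff CHECKLIST K-g57 (1)–(10); RULE K-R49 pre-announced), NODE L2704, critic VERDICT L2711 (crit g10): CLEARED — THEOREM ×1 (joint (A) engine + (B)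 binder discharge + (C) the family RW), ex-ante PRICE L2701 met 10/10, prong «infinite class of positive-genus re-amended-frontier pairs made unconditional» (K-R48 PAYABLE), rung 0; RULE K-R49 FIXED (toolkit of record ∪= 2-adic Runge certificates — the `RungeCert k c` engine `thinFibreAt_of_rungeCert`; FRONTIER re-amended by «NOT Runge-certifiable», Runge-certifiable(m₀,P) := ((deg topX < natDegree ∨ topX ℚ-reducible) ∧ eTop+1 ≤ m₀) ∨ natDegree < m₀·xdeg; standing open-territory witness W4 (census TM33)); PORT GO exactly as STAGING NOTE 8 L2708 with the port edits (a)–(d) SANCTIONED; writer RE-CHECK L2709. Port by census-1 gen 22 as `RootDecomp1KRunge01–06` (`--supports stmt-Schanuel-33364`; no census credit): 01 = §0 small facts (local copies of private tree lemmas), §1 integer coefficient tables `ev` / `ev₁` / `tabAbs`, §2 the level polynomial `ptilde` vanishing at (t_N, r) (`tQ N = 2^N!/p_N`); 02 = §3 THE 2-ADIC RUNGE ESTIMATE `runge_small` (‖Φ(t_N, r)‖₂ ≤ K·2^(−M·N!)), §4 the integer `zInt` (product formula), §5 the arithmetic endgame; 03 = §6 `structure RungeCert k c` (integral two-polynomial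 Runge certificate) and THE ENGINE **`thinFibreAt_of_rungeCert`**; 04 = §7 the member M17P: tables `m17G … m17rho`, `m17Cert : RungeCert 2 m17C`, **`thinFibreAt_M17P_runge : 2 ≤ m₀ → ThinFibreAt m₀ M17P` HYPOTHESIS-FREE** (the tree's `thinFibreAt_M17P (hS : PadicSubspace)` loses its binder); 05 = §8 the infinite class `RW w = xPolyP 5 (rwC w)` (deg w ≤ 3), the w-free certificate `rwCert`, **`thinFibreAt_RW`**, members `RW1/RW2/RW3`; 06 = §9 TERRITORY certificates by tree names (section Territory). PORT EDITS (head dry-run near-duplicate notes resolved before filing, as in the node-14/15 ports): TWO delete-for-twin in §0 — K's `partialSum_two_runge` (≡ `RootDecomp1KLevelFinite.lac_partialSum_two`, LevelFinite12) and K's `norm_two_runge` (≡ `RootDecomp1KLocalExponent.norm_two_Cp`, LocalExponent01), each single use re-pointed to the tree name; TWO privatisations with file-local copies where a later part uses them — K's `norm_intCast_le_one_runge` and `norm_intCast_two_runge` (near-duplicates of BirchSwinnertonDyer decls); 62 one-line docstrings on undocumented computation lemmas (statements quoted); K's two local `set_option maxHeartbeats N in` kept verbatim; nothing else; provenance doc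 blocks + continuation headers = K's own open-lines; statements and proofs VERBATIM. Rung 0 — nothing here proves Schanuel, 33364, 33363, 31077 or ThinFibre 2; everything HYPOTHESIS-FREE.)
-/

noncomputable section

namespace Summit.Schanuel.Schanuel.Theorems.RootDecomp1KRunge

open Polynomial LiouvilleNumber
open scoped Nat
open Summit.Schanuel.Schanuel.Theorems.RootDecomp1KTwoBaseCell (psNumer partialSum_eq_psNumer_div coprime_psNumer)
open Summit.Schanuel.Schanuel.Theorems.RootDecomp1KRelLiouvilleCell (partialSum_two_strictMono
  partialSum_two_lt_liouvilleNumber)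
open Summit.Schanuel.Schanuel.Theorems.RootDecomp1KDegreeLadder
open Summit.Schanuel.Schanuel.Theorems.RootDecomp1KXLinearCore
open Summit.Schanuel.Schanuel.Theorems.RootDecomp1KXLinear
open Summit.Schanuel.Schanuel.Theorems.RootDecomp1KXLinearII
open Summit.Schanuel.Schanuel.Theorems.RootDecomp1KXTop
open Summit.Schanuel.Schanuel.Theorems.RootDecomp1KSubspaceBranch

/-- `‖(z : \overline{ℚ₂})‖ ≤ 1` for integers. -/
private theorem norm_intCast_le_one_runge (z : ℤ) : ‖(z : PadicAlgCl 2)‖ ≤ 1 := by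
  have h1 : (z : PadicAlgCl 2) = algebraMap ℚ_[2] (PadicAlgCl 2) (z : ℚ_[2]) := (map_intCast _ z).symm
  rw [h1, PadicAlgCl.norm_extends]
  exact Padic.norm_int_le_one z

/-- `|m|₂ = 2^{−v₂(m)}` for a non-zero integer `m`. -/
private theorem norm_intCast_two_runge {m : ℤ} (hm : m ≠ 0) :
    ‖(m : PadicAlgCl 2)‖ = (2 : ℝ) ^ (-(padicValInt 2 m : ℤ)) := by
  have h1 : (m : PadicAlgCl 2) = algebraMap ℚ_[2] (PadicAlgCl 2) (m : ℚ_[2]) := (map_intCast _ m).symm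
  rw [h1, PadicAlgCl.norm_extends, Padic.norm_eq_zpow_neg_valuation (by exact_mod_cast hm),
    Padic.valuation_intCast]
  norm_num

/-! ### §3 The Runge estimate: `‖Φ(t_N, r)‖₂ ≤ K · 2^{-MN!}` at level points with `‖r‖₂` bounded -/

set_option maxHeartbeats 400000 in
/-- **the 2-adic Runge estimate.**  Given `Dg · P~ = G · H + t^M · R` with `H(0, Y) = h₀ ≠ 0` and
`DΦ · Φ = V · G + t^M · E` (`DΦ ≠ 0`), at every level point `(t_N, r)` with `N ≥ N₁` and `‖r‖₂ ≤ Ry`: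
`‖Φ(t_N, r)‖₂ ≤ K · 2^{-M·N!}`. -/
theorem runge_small (k : ℕ) (c : ℕ → ℤ[X]) {M dtG dyG dtH dyH dtR dyR dtE dyE dV dtP dyP : ℕ}
    (G : Fin dtG → Fin dyG → ℤ) (H : Fin dtH → Fin dyH → ℤ) (R : Fin dtR → Fin dyR → ℤ)
    (E : Fin dtE → Fin dyE → ℤ) (Φ : Fin dtP → Fin dyP → ℤ) (V : Fin dV → ℤ) (Dg h₀ DΦ : ℤ)
    (hh₀ : h₀ ≠ 0) (hDΦ : DΦ ≠ 0)
    (hGH : ∀ t y : PadicAlgCl 2, (Dg : PadicAlgCl 2) * ptilde k c t y = ev G t y * ev H t y + t ^ M * ev R t y)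
    (hH0 : ∀ y : PadicAlgCl 2, ev H (0 : PadicAlgCl 2) y = h₀)
    (hΦ : ∀ t y : PadicAlgCl 2, (DΦ : PadicAlgCl 2) * ev Φ t y = ev₁ V t * ev G t y + t ^ M * ev E t y)
    (Ry : ℝ) :
    ∃ K : ℝ, 0 < K ∧ ∃ N₁ : ℕ, ∀ N, N₁ ≤ N → ∀ r : ℚ, bev (xPolyP k c) (partialSum 2 N) r = 0 →
      ‖(r : PadicAlgCl 2)‖ ≤ Ry →
      ‖ev Φ ((2 : PadicAlgCl 2) ^ N ! / (psNumer 2 N : PadicAlgCl 2)) (r : PadicAlgCl 2)‖ ≤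
        K * (1 / 2 : ℝ) ^ (M * N !) := by
  set My : ℝ := max 1 Ry with hMy
  have hMy1 : 1 ≤ My := le_max_left _ _
  set KH : ℝ := tabAbs H * My ^ dyH with hKH
  set KR : ℝ := tabAbs R * My ^ dyR with hKR
  set KE : ℝ := tabAbs E * My ^ dyE with hKE
  set KV : ℝ := tabAbs₁ V with hKV
  have hKH0 : 0 ≤ KH := mul_nonneg (tabAbs_nonneg _) (by positivity)
  have hKR0 : 0 ≤ KR := mul_nonneg (tabAbs_nonneg _) (by positivity)
  have hKE0 : 0 ≤ KE := mul_nonneg (tabAbs_nonneg _) (by positivity)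
  have hKV0 : 0 ≤ KV := tabAbs₁_nonneg _
  have hη : 0 < ‖(h₀ : PadicAlgCl 2)‖ := by rw [norm_pos_iff]; exact_mod_cast hh₀
  have hδ : 0 < ‖(DΦ : PadicAlgCl 2)‖ := by rw [norm_pos_iff]; exact_mod_cast hDΦ
  obtain ⟨N₁, hN₁⟩ := exists_pow_lt_of_lt_one (div_pos hη (by linarith : (0 : ℝ) < KH + 1))
    (show (1 / 2 : ℝ) < 1 by norm_num)
  have hK0 : 0 ≤ (KV * (KR / ‖(h₀ : PadicAlgCl 2)‖) + KE) / ‖(DΦ : PadicAlgCl 2)‖ := by positivity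
  refine ⟨(KV * (KR / ‖(h₀ : PadicAlgCl 2)‖) + KE) / ‖(DΦ : PadicAlgCl 2)‖ + 1, by linarith, max N₁ 3,
    fun N hN r hP hr => ?_⟩
  have hN3 : 3 ≤ N := le_trans (le_max_right _ _) hN
  have hNN₁ : N₁ ≤ N := le_trans (le_max_left _ _) hN
  set τ : PadicAlgCl 2 := (2 : PadicAlgCl 2) ^ N ! / (psNumer 2 N : PadicAlgCl 2) with hτdef
  have hτ : ‖τ‖ = (1 / 2 : ℝ) ^ N ! := norm_tN hN3
  have hτ1 : ‖τ‖ ≤ 1 := by rw [hτ]; exact pow_le_one₀ (by norm_num) (by norm_num)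
  have hy0 : 0 ≤ max 1 ‖(r : PadicAlgCl 2)‖ := by positivity
  have hyM : max 1 ‖(r : PadicAlgCl 2)‖ ≤ My := max_le hMy1 (hr.trans (le_max_right _ _))
  -- the level relation `G · H = −t^M · R` at `(t_N, r)`
  have h0 := ptilde_level k c hN3 r hP
  have hrel : ev G τ (r : PadicAlgCl 2) * ev H τ (r : PadicAlgCl 2) = -(τ ^ M * ev R τ (r : PadicAlgCl 2)) := by
    have h := hGH τ r
    rw [h0, mul_zero] at h
    exact eq_neg_of_add_eq_zero_left h.symm
  -- `H(t_N, r)` is a 2-adic unit of size `‖h₀‖`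
  have hHsub : ‖ev H τ (r : PadicAlgCl 2) - (h₀ : PadicAlgCl 2)‖ ≤ ‖τ‖ * KH := by
    rw [← hH0 (r : PadicAlgCl 2)]
    refine (norm_ev_sub_le H hτ1).trans (mul_le_mul_of_nonneg_left ?_ (norm_nonneg _))
    exact mul_le_mul_of_nonneg_left (pow_le_pow_left₀ hy0 hyM _) (tabAbs_nonneg _)
  have hHsub' : ‖ev H τ (r : PadicAlgCl 2) - (h₀ : PadicAlgCl 2)‖ < ‖(h₀ : PadicAlgCl 2)‖ := by
    have h1 : ‖τ‖ * KH ≤ (1 / 2 : ℝ) ^ N₁ * (KH + 1) := by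
      rw [hτ]
      have : (1 / 2 : ℝ) ^ N ! ≤ (1 / 2) ^ N₁ :=
        pow_le_pow_of_le_one (by norm_num) (by norm_num) (hNN₁.trans (Nat.self_le_factorial N))
      exact mul_le_mul this (by linarith) hKH0 (by positivity)
    have h2 : (1 / 2 : ℝ) ^ N₁ * (KH + 1) < ‖(h₀ : PadicAlgCl 2)‖ := by
      have := hN₁; rwa [lt_div_iff₀ (by linarith : (0 : ℝ) < KH + 1)] at this
    linarith
  have hHge : ‖(h₀ : PadicAlgCl 2)‖ ≤ ‖ev H τ (r : PadicAlgCl 2)‖ := by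
    by_contra hlt
    push Not at hlt
    have h1 : ‖(h₀ : PadicAlgCl 2)‖ ≤
        max ‖ev H τ (r : PadicAlgCl 2)‖ ‖-(ev H τ (r : PadicAlgCl 2) - (h₀ : PadicAlgCl 2))‖ := by
      calc ‖(h₀ : PadicAlgCl 2)‖
          = ‖ev H τ (r : PadicAlgCl 2) + -(ev H τ (r : PadicAlgCl 2) - (h₀ : PadicAlgCl 2))‖ := by
            congr 1; ring
        _ ≤ _ := IsUltrametricDist.norm_add_le_max _ _
    rw [norm_neg] at h1
    have h2 := max_lt hlt hHsub'
    linarith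
  -- `G(t_N, r)` is small
  have hR : ‖ev R τ (r : PadicAlgCl 2)‖ ≤ KR :=
    (norm_ev_le R hτ1).trans (mul_le_mul_of_nonneg_left (pow_le_pow_left₀ hy0 hyM _) (tabAbs_nonneg _))
  have hG : ‖ev G τ (r : PadicAlgCl 2)‖ ≤ ‖τ‖ ^ M * KR / ‖(h₀ : PadicAlgCl 2)‖ := by
    rw [le_div_iff₀ hη]
    have h1 : ‖ev G τ (r : PadicAlgCl 2)‖ * ‖(h₀ : PadicAlgCl 2)‖ ≤
        ‖ev G τ (r : PadicAlgCl 2)‖ * ‖ev H τ (r : PadicAlgCl 2)‖ :=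
      mul_le_mul_of_nonneg_left hHge (norm_nonneg _)
    refine h1.trans ?_
    rw [← norm_mul, hrel, norm_neg, norm_mul, norm_pow]
    exact mul_le_mul_of_nonneg_left hR (by positivity)
  -- `Φ(t_N, r)` is small
  have hE : ‖ev E τ (r : PadicAlgCl 2)‖ ≤ KE :=
    (norm_ev_le E hτ1).trans (mul_le_mul_of_nonneg_left (pow_le_pow_left₀ hy0 hyM _) (tabAbs_nonneg _))
  have hVn : ‖ev₁ V τ‖ ≤ KV := norm_ev₁_le V hτ1
  have hΦn : ‖(DΦ : PadicAlgCl 2)‖ * ‖ev Φ τ (r : PadicAlgCl 2)‖ ≤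
      ‖τ‖ ^ M * (KV * (KR / ‖(h₀ : PadicAlgCl 2)‖) + KE) := by
    rw [← norm_mul, hΦ τ r]
    refine (norm_add_le _ _).trans ?_
    rw [norm_mul, norm_mul, norm_pow]
    calc ‖ev₁ V τ‖ * ‖ev G τ (r : PadicAlgCl 2)‖ + ‖τ‖ ^ M * ‖ev E τ (r : PadicAlgCl 2)‖
        ≤ KV * (‖τ‖ ^ M * KR / ‖(h₀ : PadicAlgCl 2)‖) + ‖τ‖ ^ M * KE :=
          add_le_add (mul_le_mul hVn hG (norm_nonneg _) hKV0) (mul_le_mul_of_nonneg_left hE (by positivity))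
      _ = ‖τ‖ ^ M * (KV * (KR / ‖(h₀ : PadicAlgCl 2)‖) + KE) := by ring
  have hτM : ‖τ‖ ^ M = (1 / 2 : ℝ) ^ (M * N !) := by rw [hτ, ← pow_mul, mul_comm]
  have hmain : ‖ev Φ τ (r : PadicAlgCl 2)‖ ≤
      (KV * (KR / ‖(h₀ : PadicAlgCl 2)‖) + KE) / ‖(DΦ : PadicAlgCl 2)‖ * (1 / 2 : ℝ) ^ (M * N !) := by
    rw [← hτM, div_mul_eq_mul_div, le_div_iff₀ hδ, mul_comm]
    calc ‖(DΦ : PadicAlgCl 2)‖ * ‖ev Φ τ (r : PadicAlgCl 2)‖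
        ≤ ‖τ‖ ^ M * (KV * (KR / ‖(h₀ : PadicAlgCl 2)‖) + KE) := hΦn
      _ = (KV * (KR / ‖(h₀ : PadicAlgCl 2)‖) + KE) * ‖τ‖ ^ M := by ring
  have hpos : (0 : ℝ) ≤ (1 / 2 : ℝ) ^ (M * N !) := by positivity
  nlinarith

/-! ### §4 The integer `Z` (product formula) -/

/-- `Z = Σ_{i ≤ a} Σ_{j ≤ b} Φ_ij · p_N^{a-i} · 2^{i·N!} · num(r)^j · den(r)^{b-j} ∈ ℤ`
(`= p_N^a · den(r)^b · Φ(t_N, r)`). -/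
def zInt (a b : ℕ) (Φ : Fin (a + 1) → Fin (b + 1) → ℤ) (N : ℕ) (r : ℚ) : ℤ :=
  ∑ i : Fin (a + 1), ∑ j : Fin (b + 1),
    Φ i j * (psNumer 2 N : ℤ) ^ (a - i) * 2 ^ ((i : ℕ) * N !) * r.num ^ (j : ℕ) * (r.den : ℤ) ^ (b - j)

/-- `(Z : \overline{ℚ₂}) = p_N^a · den(r)^b · Φ(t_N, r)`. -/
theorem zInt_castTwo (a b : ℕ) (Φ : Fin (a + 1) → Fin (b + 1) → ℤ) (N : ℕ) (r : ℚ) :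
    ((zInt a b Φ N r : ℤ) : PadicAlgCl 2) = (psNumer 2 N : PadicAlgCl 2) ^ a * (r.den : PadicAlgCl 2) ^ b *
      ev Φ ((2 : PadicAlgCl 2) ^ N ! / (psNumer 2 N : PadicAlgCl 2)) (r : PadicAlgCl 2) := by
  have hp : (psNumer 2 N : PadicAlgCl 2) ≠ 0 := by exact_mod_cast (psNumer_pos_runge N).ne'
  have hd : (r.den : PadicAlgCl 2) ≠ 0 := by exact_mod_cast r.den_nz
  have hr : (r : PadicAlgCl 2) = (r.num : PadicAlgCl 2) / (r.den : PadicAlgCl 2) := Rat.cast_def r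
  unfold zInt ev
  push_cast
  rw [Finset.mul_sum]
  refine Finset.sum_congr rfl fun i _ => ?_
  rw [Finset.mul_sum]
  refine Finset.sum_congr rfl fun j _ => ?_
  have hi : (i : ℕ) ≤ a := Nat.lt_succ_iff.mp i.isLt
  have hj : (j : ℕ) ≤ b := Nat.lt_succ_iff.mp j.isLt
  have hpa : (psNumer 2 N : PadicAlgCl 2) ^ a =
      (psNumer 2 N : PadicAlgCl 2) ^ (a - i) * (psNumer 2 N : PadicAlgCl 2) ^ (i : ℕ) := by
    rw [← pow_add, Nat.sub_add_cancel hi]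
  have hdb : (r.den : PadicAlgCl 2) ^ b = (r.den : PadicAlgCl 2) ^ (b - j) * (r.den : PadicAlgCl 2) ^ (j : ℕ) := by
    rw [← pow_add, Nat.sub_add_cancel hj]
  rw [hr, hpa, hdb, div_pow, div_pow]
  field_simp
  ring

/-- `|Z| ≤ tabAbs Φ · 2^a · 2^{a·N!} · max(1, C)^b · den(r)^b` for `|r| ≤ C`. -/
theorem zInt_abs_le (a b : ℕ) (Φ : Fin (a + 1) → Fin (b + 1) → ℤ) (N : ℕ) {r : ℚ} {C : ℝ}
    (hr : |(r : ℝ)| ≤ C) :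
    |(zInt a b Φ N r : ℝ)| ≤ tabAbs Φ * 2 ^ a * 2 ^ (a * N !) * max 1 C ^ b * (r.den : ℝ) ^ b := by
  have hp : (psNumer 2 N : ℝ) ≤ 2 * 2 ^ N ! := by exact_mod_cast (psNumer_lt N).le
  have hp0 : (0 : ℝ) ≤ psNumer 2 N := by positivity
  have hd0 : (0 : ℝ) < r.den := by exact_mod_cast r.den_pos
  have hC1 : (1 : ℝ) ≤ max 1 C := le_max_left _ _
  have hnum : |(r.num : ℝ)| ≤ max 1 C * r.den := by
    have h1 : (r.num : ℝ) = (r : ℝ) * r.den := by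
      have h := Rat.mul_den_eq_num r
      exact_mod_cast h.symm
    rw [h1, abs_mul, Nat.abs_cast]
    exact mul_le_mul_of_nonneg_right (hr.trans (le_max_right _ _)) hd0.le
  unfold zInt tabAbs
  push_cast
  rw [Finset.sum_mul, Finset.sum_mul, Finset.sum_mul, Finset.sum_mul]
  refine (Finset.abs_sum_le_sum_abs _ _).trans (Finset.sum_le_sum fun i _ => ?_)
  rw [Finset.sum_mul, Finset.sum_mul, Finset.sum_mul, Finset.sum_mul]
  refine (Finset.abs_sum_le_sum_abs _ _).trans (Finset.sum_le_sum fun j _ => ?_)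
  have hi : (i : ℕ) ≤ a := Nat.lt_succ_iff.mp i.isLt
  have hj : (j : ℕ) ≤ b := Nat.lt_succ_iff.mp j.isLt
  rw [abs_mul, abs_mul, abs_mul, abs_mul]
  have h1 : |(psNumer 2 N : ℝ) ^ (a - i)| * |(2 : ℝ) ^ ((i : ℕ) * N !)| ≤ 2 ^ a * 2 ^ (a * N !) := by
    rw [abs_pow, abs_pow, Nat.abs_cast, abs_two]
    calc (psNumer 2 N : ℝ) ^ (a - i) * 2 ^ ((i : ℕ) * N !)
        ≤ (2 * 2 ^ N !) ^ (a - i) * 2 ^ ((i : ℕ) * N !) :=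
          mul_le_mul_of_nonneg_right (pow_le_pow_left₀ hp0 hp _) (by positivity)
      _ = 2 ^ (a - i) * 2 ^ (a * N !) := by
          rw [mul_pow, ← pow_mul, mul_assoc, ← pow_add]
          congr 2
          rw [mul_comm (N !) (a - (i : ℕ)), ← add_mul, Nat.sub_add_cancel hi]
      _ ≤ 2 ^ a * 2 ^ (a * N !) :=
          mul_le_mul_of_nonneg_right (pow_le_pow_right₀ (by norm_num) (Nat.sub_le _ _)) (by positivity)
  have h2 : |(r.num : ℝ) ^ (j : ℕ)| * |(r.den : ℝ) ^ (b - j)| ≤ max 1 C ^ b * (r.den : ℝ) ^ b := by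
    rw [abs_pow, abs_pow, Nat.abs_cast]
    calc |(r.num : ℝ)| ^ (j : ℕ) * (r.den : ℝ) ^ (b - j)
        ≤ (max 1 C * r.den) ^ (j : ℕ) * (r.den : ℝ) ^ (b - j) :=
          mul_le_mul_of_nonneg_right (pow_le_pow_left₀ (abs_nonneg _) hnum _) (by positivity)
      _ = max 1 C ^ (j : ℕ) * (r.den : ℝ) ^ b := by
          rw [mul_pow, mul_assoc, ← pow_add, Nat.add_sub_cancel' hj]
      _ ≤ max 1 C ^ b * (r.den : ℝ) ^ b :=
          mul_le_mul_of_nonneg_right (pow_le_pow_right₀ hC1 hj) (by positivity)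
  calc |(Φ i j : ℝ)| * |(psNumer 2 N : ℝ) ^ (a - i)| * |(2 : ℝ) ^ ((i : ℕ) * N !)| * |(r.num : ℝ) ^ (j : ℕ)| *
        |(r.den : ℝ) ^ (b - j)|
      = |(Φ i j : ℝ)| * ((|(psNumer 2 N : ℝ) ^ (a - i)| * |(2 : ℝ) ^ ((i : ℕ) * N !)|) *
          (|(r.num : ℝ) ^ (j : ℕ)| * |(r.den : ℝ) ^ (b - j)|)) := by ring
    _ ≤ |(Φ i j : ℝ)| * ((2 ^ a * 2 ^ (a * N !)) * (max 1 C ^ b * (r.den : ℝ) ^ b)) :=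
        mul_le_mul_of_nonneg_left (mul_le_mul h1 h2 (by positivity) (by positivity)) (abs_nonneg _)
    _ = |(Φ i j : ℝ)| * 2 ^ a * 2 ^ (a * N !) * max 1 C ^ b * (r.den : ℝ) ^ b := by ring

/-- the product formula for a non-zero integer: `‖Z‖₂ ≤ K · 2^{-m}` forces `2^m ≤ K · |Z|`. -/
theorem two_pow_le_of_norm_le {z : ℤ} (hz : z ≠ 0) {K : ℝ} {m : ℕ}
    (h : ‖(z : PadicAlgCl 2)‖ ≤ K * (1 / 2 : ℝ) ^ m) : (2 : ℝ) ^ m ≤ K * |(z : ℝ)| := by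
  rw [norm_intCast_two_runge hz] at h
  set v : ℕ := padicValInt 2 z with hv
  have hdvd : ((2 : ℕ) : ℤ) ^ v ∣ z := padicValInt_dvd z
  have hle : (2 : ℤ) ^ v ≤ |z| := Int.le_of_dvd (abs_pos.mpr hz) ((dvd_abs _ _).mpr (by exact_mod_cast hdvd))
  have hleR : (2 : ℝ) ^ v ≤ |(z : ℝ)| := by exact_mod_cast hle
  have h2v : (0 : ℝ) < 2 ^ v := by positivity
  have h2m : (0 : ℝ) < 2 ^ m := by positivity
  have hzpow : (2 : ℝ) ^ (-(v : ℤ)) = (2 ^ v)⁻¹ := by rw [zpow_neg, zpow_natCast]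
  have h1 : (1 / 2 : ℝ) ^ m = (2 ^ m)⁻¹ := by rw [one_div, inv_pow]
  rw [hzpow, h1] at h
  have hK : (2 : ℝ) ^ m * (2 ^ v)⁻¹ ≤ K := by
    calc (2 : ℝ) ^ m * (2 ^ v)⁻¹ ≤ 2 ^ m * (K * (2 ^ m)⁻¹) := mul_le_mul_of_nonneg_left h h2m.le
      _ = K := by field_simp
  have hK0 : 0 ≤ K := le_trans (by positivity) hK
  calc (2 : ℝ) ^ m = (2 ^ m * (2 ^ v)⁻¹) * 2 ^ v := by field_simp
    _ ≤ K * 2 ^ v := mul_le_mul_of_nonneg_right hK h2v.le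
    _ ≤ K * |(z : ℝ)| := mul_le_mul_of_nonneg_left hleR hK0

/-- **the product-formula step**: if `‖Φ(t_N, r)‖₂ ≤ K · 2^{-MN!}` and `den(r)^b < 2^{(M-a)N!}/(K · …)`, then `Z = 0`. -/
theorem zInt_eq_zero_of_small {a b M : ℕ} (Φ : Fin (a + 1) → Fin (b + 1) → ℤ) (haM : a ≤ M) {K C : ℝ}
    (hK : 0 ≤ K) {N : ℕ} {r : ℚ} (hr : |(r : ℝ)| ≤ C)
    (hsmall : ‖ev Φ ((2 : PadicAlgCl 2) ^ N ! / (psNumer 2 N : PadicAlgCl 2)) (r : PadicAlgCl 2)‖ ≤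
      K * (1 / 2 : ℝ) ^ (M * N !))
    (hbig : ¬ (2 : ℝ) ^ ((M - a) * N !) ≤ K * (tabAbs Φ * 2 ^ a * max 1 C ^ b) * (r.den : ℝ) ^ b) :
    zInt a b Φ N r = 0 := by
  by_contra hz
  have hp1 : ‖(psNumer 2 N : PadicAlgCl 2)‖ ≤ 1 := by exact_mod_cast norm_intCast_le_one_runge (psNumer 2 N : ℤ)
  have hd1 : ‖(r.den : PadicAlgCl 2)‖ ≤ 1 := by exact_mod_cast norm_intCast_le_one_runge (r.den : ℤ)
  have hnorm : ‖((zInt a b Φ N r : ℤ) : PadicAlgCl 2)‖ ≤ K * (1 / 2 : ℝ) ^ (M * N !) := by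
    rw [zInt_castTwo, norm_mul, norm_mul, norm_pow, norm_pow]
    have h1 : ‖(psNumer 2 N : PadicAlgCl 2)‖ ^ a * ‖(r.den : PadicAlgCl 2)‖ ^ b ≤ 1 :=
      mul_le_one₀ (pow_le_one₀ (norm_nonneg _) hp1) (by positivity) (pow_le_one₀ (norm_nonneg _) hd1)
    calc ‖(psNumer 2 N : PadicAlgCl 2)‖ ^ a * ‖(r.den : PadicAlgCl 2)‖ ^ b *
          ‖ev Φ ((2 : PadicAlgCl 2) ^ N ! / (psNumer 2 N : PadicAlgCl 2)) (r : PadicAlgCl 2)‖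
        ≤ 1 * (K * (1 / 2 : ℝ) ^ (M * N !)) := mul_le_mul h1 hsmall (norm_nonneg _) zero_le_one
      _ = K * (1 / 2 : ℝ) ^ (M * N !) := one_mul _
  have h2 := two_pow_le_of_norm_le hz hnorm
  have h3 := zInt_abs_le a b Φ N hr
  have h4 : (2 : ℝ) ^ (M * N !) ≤ K * (tabAbs Φ * 2 ^ a * 2 ^ (a * N !) * max 1 C ^ b * (r.den : ℝ) ^ b) :=
    h2.trans (mul_le_mul_of_nonneg_left h3 hK)
  apply hbig
  have hsplit : (2 : ℝ) ^ (M * N !) = 2 ^ ((M - a) * N !) * 2 ^ (a * N !) := by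
    rw [← pow_add, ← add_mul, Nat.sub_add_cancel haM]
  have h2a : (0 : ℝ) < 2 ^ (a * N !) := by positivity
  rw [hsplit] at h4
  have h5 : K * (tabAbs Φ * 2 ^ a * 2 ^ (a * N !) * max 1 C ^ b * (r.den : ℝ) ^ b) =
      K * (tabAbs Φ * 2 ^ a * max 1 C ^ b) * (r.den : ℝ) ^ b * 2 ^ (a * N !) := by ring
  rw [h5] at h4
  exact le_of_mul_le_mul_right h4 h2a

/-! ### §5 The arithmetic endgame -/

/-- `den(r)^b ≥ 2^{(M-a)N!}/K₁` contradicts the negated clause `den(r)^{m₀N} ≤ C·2^{(N+1)!}` for `N ≥ N₂`,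
as soon as `(M - a)·m₀ ≥ b + 1`. -/
theorem runge_arith (K₁ C : ℝ) (b m₀ M a : ℕ) (hexp : b + 1 ≤ (M - a) * m₀) :
    ∃ N₂ : ℕ, ∀ N, N₂ ≤ N → ∀ d : ℕ, 1 ≤ d →
      (2 : ℝ) ^ ((M - a) * N !) ≤ K₁ * (d : ℝ) ^ b → C * 2 ^ (N + 1)! < (d : ℝ) ^ (m₀ * N) := by
  set K : ℝ := max 1 K₁ with hK
  set C' : ℝ := max 1 C with hC'
  have hK1 : 1 ≤ K := le_max_left _ _
  have hC1 : 1 ≤ C' := le_max_left _ _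
  set G : ℝ := K ^ m₀ * C' ^ b with hG
  have hG1 : 1 ≤ G := one_le_mul_of_one_le_of_one_le (one_le_pow₀ hK1) (one_le_pow₀ hC1)
  obtain ⟨N₂, hN₂⟩ := eventually_pow_le' G (b + 1)
  refine ⟨max N₂ (b + 2), fun N hN d hd h => ?_⟩
  have hNN₂ : N₂ ≤ N := le_trans (le_max_left _ _) hN
  have hNb : b + 2 ≤ N := le_trans (le_max_right _ _) hN
  by_contra hcl
  push Not at hcl
  have hd1 : (1 : ℝ) ≤ d := by exact_mod_cast hd
  have h1 : (2 : ℝ) ^ ((M - a) * N !) ≤ K * (d : ℝ) ^ b :=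
    h.trans (mul_le_mul_of_nonneg_right (le_max_right _ _) (by positivity))
  have h2 : (2 : ℝ) ^ ((M - a) * N ! * (m₀ * N)) ≤ K ^ (m₀ * N) * (d : ℝ) ^ (b * (m₀ * N)) := by
    rw [pow_mul, pow_mul (d : ℝ), ← mul_pow]
    exact pow_le_pow_left₀ (by positivity) h1 _
  have h3 : (d : ℝ) ^ (b * (m₀ * N)) ≤ C' ^ b * 2 ^ (b * (N + 1)!) := by
    have h3' : ((d : ℝ) ^ (m₀ * N)) ^ b ≤ (C' * 2 ^ (N + 1)!) ^ b :=
      pow_le_pow_left₀ (by positivity) (hcl.trans (mul_le_mul_of_nonneg_right (le_max_right _ _)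
        (by positivity))) _
    rw [mul_pow, ← pow_mul, ← pow_mul] at h3'
    rwa [mul_comm (m₀ * N) b, mul_comm ((N + 1)!) b] at h3'
  have h4 : K ^ (m₀ * N) * C' ^ b ≤ G ^ (N + 1) := by
    rw [hG, mul_pow, ← pow_mul, ← pow_mul]
    exact mul_le_mul (pow_le_pow_right₀ hK1 (by nlinarith)) (pow_le_pow_right₀ hC1 (by nlinarith))
      (by positivity) (by positivity)
  have h5 := hN₂ N hNN₂
  have h6 : (2 : ℝ) ^ ((M - a) * N ! * (m₀ * N)) ≤ 2 ^ ((N - (b + 1)) * N ! + b * (N + 1)!) := by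
    rw [pow_add]
    calc (2 : ℝ) ^ ((M - a) * N ! * (m₀ * N)) ≤ K ^ (m₀ * N) * (d : ℝ) ^ (b * (m₀ * N)) := h2
      _ ≤ K ^ (m₀ * N) * (C' ^ b * 2 ^ (b * (N + 1)!)) := mul_le_mul_of_nonneg_left h3 (by positivity)
      _ = (K ^ (m₀ * N) * C' ^ b) * 2 ^ (b * (N + 1)!) := by ring
      _ ≤ G ^ (N + 1) * 2 ^ (b * (N + 1)!) := mul_le_mul_of_nonneg_right h4 (by positivity)
      _ ≤ 2 ^ ((N - (b + 1)) * N !) * 2 ^ (b * (N + 1)!) := mul_le_mul_of_nonneg_right h5 (by positivity)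
  have h7 : (M - a) * N ! * (m₀ * N) ≤ (N - (b + 1)) * N ! + b * (N + 1)! :=
    (pow_le_pow_iff_right₀ (by norm_num : (1 : ℝ) < 2)).mp h6
  -- the exponent inequality is false
  obtain ⟨n, rfl⟩ := Nat.exists_eq_add_of_le hNb
  have hF : 1 ≤ (b + 2 + n) ! := Nat.succ_le_of_lt (Nat.factorial_pos _)
  rw [Nat.factorial_succ (b + 2 + n), show b + 2 + n - (b + 1) = n + 1 by omega] at h7
  set F : ℕ := (b + 2 + n) ! with hFdef
  set X : ℕ := M - a with hX
  have hL : (b + 1) * (F * (b + 2 + n)) ≤ X * F * (m₀ * (b + 2 + n)) := by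
    calc (b + 1) * (F * (b + 2 + n)) ≤ X * m₀ * (F * (b + 2 + n)) := Nat.mul_le_mul_right _ hexp
      _ = X * F * (m₀ * (b + 2 + n)) := by ring
  have key := hL.trans h7
  ring_nf at key
  nlinarith [key, hF]

end Summit.Schanuel.Schanuel.Theorems.RootDecomp1KRunge

end
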